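import Summits.NavierStokesRegularity.NavierStokesRegularity.Theses.AncientHullSteering
import Summits.NavierStokesRegularity.NavierStokesRegularity.Theses.DssFarFieldSlaving
import Summits.NavierStokesRegularity.NavierStokesRegularity.Theorems.DssFarFieldSlavingDssTruncationBridge
import HarnessLib

/-!
# Route `AncientHullSteering`, rung `AncientTruncationBridge` (stmt-NavierStokesRegularity-20185):
  the rung SPECIALISES to its proved floor (forward-discipline F3 / BC5, kernel form)

The rung `AncientTruncationBridge` is the floor `DssFarFieldSlaving.DssTruncationBridgeTypeI`
(stmt-NavierStokesRegularity-14478, proved: `Theorems.dssTruncationBridgeTypeI_proof`) with the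
rotated-discrete-self-similarity hypothesis DELETED from the profile. This file records the
specialisation as a theorem BY ITEM NAME:

* `dssTruncationBridgeTypeI_of_ancientTruncationBridge : AncientTruncationBridge →
  DssFarFieldSlaving.DssTruncationBridgeTypeI` — restricting the rung to rotated-DSS profiles gives
  back exactly the floor: the negated Type-I (rotated) DSS Liouville wall supplies a nontrivial
  Type-I rotated-DSS ancient mild solution (`Theorems.exists_typeI_rdss_ancient_of_not_liouville`,
  in tree), which is in particular a nontrivial ancient mild solution with measurable slices and
  Type-I space–time decay, i.e. an inhabitant of the rung's antecedent; the rung's consequent is the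
  floor's consequent verbatim.

So the ladder reads floor (RDSS profiles, PROVED) ⊂ rung (all Type-I-decaying ancient profiles,
open, stmt-20185); the other end of the rung is pinned by the companion file
`AncientHullSteeringAncientTruncationBridgeOnpath.lean` (under Clay (A) the rung is equivalent to the
conditional Type-I Liouville theorem). No statement of any route is asserted here.

References: Z. Bradshaw, T.-P. Tsai, Comm. PDE 42 (2017), §5 Open Problem 5.1 (the Type-I RDSS
Liouville problem) [BradshawTsai2017CPDE]; G. Koch, N. Nadirashvili, G. Seregin, V. Šverák, Acta
Math. 203 (2009) §1 [KochNadirashviliSereginSverak2009].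
-/

noncomputable section

set_option linter.dupNamespace false

namespace Summit.NavierStokesRegularity.NavierStokesRegularity.Theorems.AncientHullSteeringOnpath

open MeasureTheory
open Literature.Analysis.FluidPDE
open Summit.NavierStokesRegularity.NavierStokesRegularity.Theses

/-- **The rung specialises to its floor.** `AncientHullSteering.AncientTruncationBridge` (every
nontrivial Type-I-decaying ancient mild solution truncates to a finite-energy Type-I blow-up) implies
`DssFarFieldSlaving.DssTruncationBridgeTypeI` (stmt-NavierStokesRegularity-14478, the same for the
profiles produced by the negated Type-I rotated-DSS Liouville wall): such a profile is a nontrivial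
ancient mild solution (`ν = 1`) with measurable slices and Type-I decay by
`Theorems.exists_typeI_rdss_ancient_of_not_liouville` (forget `IsRotatedDSS`), and the two
consequents coincide verbatim. The floor itself is the proved
`Theorems.dssTruncationBridgeTypeI_proof`. [cite: BradshawTsai2017CPDE, §5 Open Problem 5.1] -/
theorem dssTruncationBridgeTypeI_of_ancientTruncationBridge
    (hR : AncientHullSteering.AncientTruncationBridge) :
    DssFarFieldSlaving.DssTruncationBridgeTypeI := by
  intro hneg
  obtain ⟨c, R, u, -, hu, hmeas, -, hdec, hnt⟩ :=
    Theorems.exists_typeI_rdss_ancient_of_not_liouville hneg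
  exact hR ⟨u, hu, hmeas, hdec, hnt⟩

end Summit.NavierStokesRegularity.NavierStokesRegularity.Theorems.AncientHullSteeringOnpath

end
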